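import Literature.NumberTheory.EllipticCurves.InertiaInvariantsKodairaNeronMultiplicativeProofs
import Literature.NumberTheory.EllipticCurves.KodairaNeronMultiplicativeProofs
import Literature.NumberTheory.EllipticCurves.GaloisActionProofs
import Literature.NumberTheory.EllipticCurves.PointDivisibilityProofs
import HarnessLib

/-!
# Multiplicative reduction with `p^k ∤ v(Δ)`: the inertia group moves a `p^k`-torsion point
# (level-`p^k` form of `MultiplicativeRamifiedTorsionProofs`; cell `b2b-bsdres`, team n1011, seat
# p14 gen 2 — row T-b10 'wild tower at 3', ARM B, step (A) of `cells/n1011/skel/T-b9x-nine.md`)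

`Proofs` file (theorems only, no definitions, no named facts) in topic
`NumberTheory/EllipticCurves`, sibling of `MultiplicativeRamifiedTorsionProofs.lean` (the case
`k = 1`).  The Tate-curve dictionary at a multiplicative place `v ∤ p` says that the inertia group
acts on `E[p^k]` through the cyclic unipotent group `⟨(1 v(Δ_min); 0 1)⟩` of order
`p^k / gcd(p^k, v(Δ_min))` (Silverman, *ATAEC*, V.4–V.5 and Exercise 5.13(b), PDF p. 416: the image
of inertia in `Aut(T_p E) ≅ GL₂(ℤ_p)` is `{(1 b; 0 1) : ord_p(b) ≥ ord_p(v_K(j_E))}`; Serre,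
*Abelian ℓ-adic representations*, Ch. IV, A.1.2); in particular **`E[p^k]` is ramified at `v` as
soon as `p^k ∤ v(Δ_min)`**.  This file proves that direction,

* `IsDedekindDomain.HeightOneSpectrum.exists_inertia_map_ne_pow_of_multiplicative` — for an
  integral equation `X₀` over `𝓞_v` with nodal reduction (`c₄ ∈ 𝓞_v^×`) and `Δ(X₀) = u π^n`
  (`u ∈ 𝓞_v^×`, `n ≥ 1`), a prime `p` with `v ∤ p` and `k ≥ 1` with `p^k ∤ n`: some element of the
  inertia group `I_𝔐 ≤ Γ_{K_v}` moves some point `P ∈ X₀(K̄_v)` with `p^k P = O`,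

WITHOUT the Tate curve, by the Kodaira–Néron count of the sibling file (Silverman, *ATAEC*,
Cor. IV.9.2(d): `[E(K_v^nr) : E₀] = v(Δ)` for split multiplicative reduction; *AEC* VII.2.1,
III.2.5, VII.3.1: `E₀/E₁ ↪ \bar k^×`, `E₁` has no `p`-torsion) with one change: if `I_𝔐` fixed
`E[p^k]`, every `P ∈ E[p]` is `p^{k-1} R` with `R ∈ E[p^k]` rational over `K_v^nr`, `nR ∈ E₀` and
`p^k R = O`, so `gcd(n, p^k) R ∈ E₀` with `gcd(n, p^k) ∣ p^{k-1}` (as `p^k ∤ n`), whence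
`P ∈ E₀`; the node map then embeds `E[p]` (order `p²`) into the `p`-th roots of unity (`≤ p`).

Use (cell `bsd-rank1-residual`, row T-b10 ARM B): at `p = 3`, `k = 2`, a multiplicative prime
`ℓ ≠ 3` of `E/ℚ` with `9 ∤ v_ℓ(Δ_min)` gives an inertia element moving a point of `E[9]`; being
unipotent with `(τ - 1)² = 0` (`MultiplicativeUnipotentTorsionProofs`) it yields, by
`GaloisImage/NineTorsionUnipotentWitness.lean`, the `3`-adic tower from surj(3).

## References

* [SilvermanATAEC1994] J. H. Silverman, *Advanced Topics in the Arithmetic of Elliptic Curves*,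
  GTM 151 (1994): Cor. IV.9.2(d) (PDF p. 340); V.4–V.5; Exercise 5.13(b) (PDF p. 416) and its
  attribution (PDF p. 441).
* [SilvermanAEC2009] J. H. Silverman, *The Arithmetic of Elliptic Curves*, 2nd ed. (2009):
  VII.2.1, VII.3.1, III.2.5, Cor. III.6.4(b).
* [SerreAbelianLadic1968] J.-P. Serre, *Abelian `ℓ`-adic representations and elliptic curves*
  (1968), Ch. IV, A.1.2.

## Design

Same as the sibling: no definitions; `open scoped Classical NNReal`; one universe `u`; the spectral
valuation quantified with `hw`; `set_option maxHeartbeats` raised for the main theorem.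
-/

noncomputable section

open scoped Classical NNReal
open NumberField IsDedekindDomain Field Polynomial IsLocalRing

universe u

namespace IsDedekindDomain.HeightOneSpectrum

open Literature.NumberTheory.EllipticCurves Literature.NumberTheory.EllipticCurves.LocalIndex
  Literature.NumberTheory.GaloisRepresentations
  Literature.NumberTheory.GaloisRepresentations.IsNonarchimedeanLocalField
  Literature.NumberTheory.DiophantineGeometry Literature.NumberTheory.DiophantineGeometry.TateAlgorithm

variable {K : Type u} [Field K] [NumberField K] {v : HeightOneSpectrum (𝓞 K)}
  {w : Valuation (AlgebraicClosure (v.adicCompletion K)) ℝ≥0}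
  (hw : ∀ x, (w x : ℝ) = spectralNorm (v.adicCompletion K) (AlgebraicClosure (v.adicCompletion K)) x)

include hw in
set_option maxHeartbeats 4000000 in
/-- **Multiplicative reduction with `p^k ∤ v(Δ)`: the inertia group moves a `p^k`-torsion point.**
Let `K` be a number field, `v` a finite place, `X₀` a Weierstrass equation over `𝓞_v` with
`c₄(X₀) ∈ 𝓞_v^×` and `Δ(X₀) = u π^n` (`u ∈ 𝓞_v^×`, `π` a uniformiser, `n ≥ 1`), `p` a prime with
`v ∤ p`, `k ≥ 1` with `p^k ∤ n`, and `𝔐` the prime of `\bar 𝓞_v ⊆ K̄_v` above `𝓂_v` with inertia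
group `I_𝔐 ≤ Γ_{K_v}`.  Then some `σ ∈ I_𝔐` moves some point `P ∈ X₀(K̄_v)` with `p^k P = O`
(Tate-curve dictionary: the image of inertia in `Aut(E[p^k])` is `⟨(1 v(Δ); 0 1)⟩`, of order
`p^k / gcd(p^k, v(Δ))`, Silverman *ATAEC* Ex. 5.13(b) / Serre IV A.1.2; `k = 1` is the tree's
`exists_inertia_map_ne_of_multiplicative`, whose Kodaira–Néron proof is followed verbatim).  Proof:
if `I_𝔐` fixed `E[p^k]`, then for `P ∈ E[p]` write `P = p^{k-1} R` with `R ∈ E[p^k]`; `R` is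
`K_v^nr`-rational, `nR ∈ E₀` (`[E(K_v^nr) : E₀] = n`) and `p^k R = O ∈ E₀`, so
`gcd(n, p^k) R ∈ E₀` with `gcd(n, p^k) ∣ p^{k-1}`, whence `P ∈ E₀`; thus the node map embeds all of
`E[p]` (order `p²`) into the `p`-th roots of unity of `\bar k` (at most `p`) — contradiction.
[cite: SilvermanATAEC1994, Cor. IV.9.2(d) (PDF p. 340) and Exercise 5.13(b) (PDF p. 416)]
[cite: SilvermanAEC2009, Prop. VII.2.1, Prop. VII.3.1, Prop. III.2.5, Cor. III.6.4(b)]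
[cite: SerreAbelianLadic1968, Ch. IV, A.1.2] -/
theorem exists_inertia_map_ne_pow_of_multiplicative
    (X₀ : WeierstrassCurve (v.adicCompletionIntegers K)) {u π : v.adicCompletionIntegers K}
    (hu : IsUnit u) (hπ : Irreducible π) {n : ℕ} (hn : 1 ≤ n) (hΔ : X₀.Δ = u * π ^ n)
    (hc₄ : X₀.c₄ ∉ maximalIdeal (v.adicCompletionIntegers K))
    {p : ℕ} (hp : p.Prime) (hpv : (p : 𝓞 K) ∉ v.asIdeal) {k : ℕ} (hk : 1 ≤ k)
    (hpn : ¬ p ^ k ∣ n)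
    {𝔐 : Ideal v.localAbsIntegers} (h𝔐 : 𝔐 ∈ v.localPrimesAbove) :
    ∃ σ ∈ 𝔐.inertia (absoluteGaloisGroup (v.adicCompletion K)),
      ∃ P : ((X₀.baseChange (v.adicCompletion K)).baseChange
          (AlgebraicClosure (v.adicCompletion K))).toAffine.Point,
        p ^ k • P = 0 ∧
          WeierstrassCurve.Affine.Point.map
            ((absoluteGaloisGroup.toAlgEquiv _ σ :
                (AlgebraicClosure (v.adicCompletion K)) ≃ₐ[(v.adicCompletion K)]
                  (AlgebraicClosure (v.adicCompletion K))) :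
              (AlgebraicClosure (v.adicCompletion K)) →ₐ[(v.adicCompletion K)]
                (AlgebraicClosure (v.adicCompletion K))) P ≠ P := by
  by_contra hall
  push Not at hall
  -- the setting, as in `KodairaNeronMultiplicativeProofs`
  set X : WeierstrassCurve (v.adicCompletion K) := X₀.baseChange (v.adicCompletion K) with hXdef
  letI instDec : DecidableEq (maxUnramified (v.adicCompletion K)) :=
    fun a b => Classical.propDecidable (a = b)
  haveI := isDiscreteValuationRing_unrIntegers hw
  haveI := henselianLocalRing_unrIntegers hw
  obtain ⟨φ, hφ⟩ := exists_ringHom_adicCompletionIntegers_unrIntegers hw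
  obtain ⟨ψ, hψ⟩ := exists_ringHom_unrIntegers_integer (w := w) (v := v) (K := K)
  have hvR := integers_valuationRing_valuation (Valuation.valuationSubring (Valuation.comap
    (algebraMap (maxUnramified (v.adicCompletion K)) (AlgebraicClosure (v.adicCompletion K))) w))
    (maxUnramified (v.adicCompletion K))
  have hinjR := IsFractionRing.injective (Valuation.valuationSubring (Valuation.comap
    (algebraMap (maxUnramified (v.adicCompletion K)) (AlgebraicClosure (v.adicCompletion K))) w))
    (maxUnramified (v.adicCompletion K))
  have hv0 : w.Integers w.integer := Valuation.integer.integers w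
  have hinj0 : Function.Injective (algebraMap w.integer (AlgebraicClosure (v.adicCompletion K))) :=
    hv0.hom_inj
  -- valuations of `p`
  have hpw : w ((p : ℤ) : AlgebraicClosure (v.adicCompletion K)) = 1 :=
    spectralValuation_intCast_eq_one hw (n := (p : ℤ)) (by simpa using hpv)
  have hpL : ((p : ℕ) : AlgebraicClosure (v.adicCompletion K)) ≠ 0 := by
    intro h0
    have : w ((p : ℤ) : AlgebraicClosure (v.adicCompletion K)) = 0 := by
      rw [Int.cast_natCast, h0, map_zero]
    rw [hpw] at this
    exact one_ne_zero this
  -- `X` is an elliptic curve: `Δ(X₀) = u π^n ≠ 0`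
  have hπ0 : π ≠ 0 := hπ.ne_zero
  have hΔ0 : X₀.Δ ≠ 0 := by
    rw [hΔ]; exact mul_ne_zero hu.ne_zero (pow_ne_zero _ hπ0)
  haveI hXell : X.IsElliptic := by
    refine ⟨isUnit_iff_ne_zero.mpr ?_⟩
    change (X₀.map (algebraMap _ _)).Δ ≠ 0
    rw [WeierstrassCurve.map_Δ]
    exact fun h ↦ hΔ0 (IsFractionRing.injective (v.adicCompletionIntegers K) (v.adicCompletion K)
      (by rw [h, map_zero]))
  -- multiplicative conditions on `X₀`, transferred to `J = X₀ ⊗ 𝒪ⁿʳ`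
  have hπm : π ∈ maximalIdeal (v.adicCompletionIntegers K) :=
    (IsLocalRing.mem_maximalIdeal _).mpr hπ.not_isUnit
  have hΔm : X₀.Δ ∈ maximalIdeal (v.adicCompletionIntegers K) := by
    rw [hΔ]
    obtain ⟨k, rfl⟩ : ∃ k, n = k + 1 := ⟨n - 1, by omega⟩
    rw [pow_succ, ← mul_assoc]
    exact Ideal.mul_mem_left _ _ hπm
  set J := X₀.map φ with hJdef
  have hΔI : J.Δ ∈ maximalIdeal (Valuation.valuationSubring (Valuation.comap (algebraMap
      (maxUnramified (v.adicCompletion K)) (AlgebraicClosure (v.adicCompletion K))) w)) := by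
    rw [hJdef, WeierstrassCurve.map_Δ]; exact (map_mem_maximalIdeal_iff hw hφ _).mpr hΔm
  have hc₄I : J.c₄ ∉ maximalIdeal (Valuation.valuationSubring (Valuation.comap (algebraMap
      (maxUnramified (v.adicCompletion K)) (AlgebraicClosure (v.adicCompletion K))) w)) := by
    rw [hJdef, WeierstrassCurve.map_c₄]; exact fun h ↦ hc₄ ((map_mem_maximalIdeal_iff hw hφ _).mp h)
  have hΔI0 : J.Δ ≠ 0 := by
    rw [hJdef, WeierstrassCurve.map_Δ]
    exact fun h0 ↦ hΔ0 (injective_of_coe_eq_algebraMap hφ (by rw [h0, map_zero]))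
  -- (1) Tate normal form over the henselian `𝒪ⁿʳ`; its exponent is `n`; `[J(K_v^nr) : E₀] = n`
  have hsplit := exists_splitNode_root_unrIntegers hw J hΔI hc₄I
  obtain ⟨D, h1, h2, h3, h4, h6⟩ := J.exists_variableChange_eq_tateNormalForm hΔI hc₄I hsplit
  set J' := D • J with hJ'
  have hJ'Δ : J'.Δ ≠ 0 := fun h0 ↦ by
    rw [hJ', WeierstrassCurve.variableChange_Δ, mul_eq_zero] at h0
    rcases h0 with h0 | h0
    · exact (D.u⁻¹ ^ 12).isUnit.ne_zero (by simpa only [Units.val_pow_eq_pow_val] using h0)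
    · exact hΔI0 h0
  have ha0 : J'.a₆ ≠ 0 := fun h0 ↦ by
    apply hJ'Δ
    rw [J'.Δ_eq_of_tateNormalForm h1 h2 h3 h4, h0, zero_mul, neg_zero]
  have hϖ' : Irreducible (φ π) := irreducible_map_of_coe_eq_algebraMap hw hφ hπ
  obtain ⟨m, α, hα⟩ := IsDiscreteValuationRing.eq_unit_mul_pow_irreducible ha0 hϖ'
  have hm1 : 1 ≤ m := by
    rcases Nat.eq_zero_or_pos m with h0 | hpos
    · exfalso
      rw [h0, pow_zero, mul_one] at hα
      rw [hα] at h6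
      exact (IsLocalRing.mem_maximalIdeal _).mp h6 α.isUnit
    · exact hpos
  -- `m = n`: compare the two factorisations of `Δ(J')`
  have hmn : m = n := by
    have hφu : IsUnit (φ u) := (isUnit_map_iff hw hφ u).mpr hu
    have h432 : IsUnit (1 + 432 * J'.a₆) := by
      by_contra hnu
      have hmem : 1 + 432 * J'.a₆ ∈ maximalIdeal _ := (IsLocalRing.mem_maximalIdeal _).mpr hnu
      have h1mem : (1 : Valuation.valuationSubring (Valuation.comap (algebraMap
          (maxUnramified (v.adicCompletion K)) (AlgebraicClosure (v.adicCompletion K))) w)) ∈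
          maximalIdeal _ := by
        have := Ideal.sub_mem _ hmem (Ideal.mul_mem_left _ 432 h6)
        rwa [add_sub_cancel_right] at this
      exact (IsLocalRing.mem_maximalIdeal _).mp h1mem isUnit_one
    have hlhs : J'.Δ = ↑((-1 : (Valuation.valuationSubring (Valuation.comap (algebraMap
        (maxUnramified (v.adicCompletion K)) (AlgebraicClosure (v.adicCompletion K))) w))ˣ) *
        α * h432.unit) * φ π ^ m := by
      rw [J'.Δ_eq_of_tateNormalForm h1 h2 h3 h4]
      conv_lhs => rw [hα]
      simp only [Units.val_mul, Units.val_neg, Units.val_one, IsUnit.unit_spec]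
      conv_rhs => rw [show (1 + 432 * J'.a₆) = (1 + 432 * (↑α * φ π ^ m)) by rw [hα]]
      ring
    have hrhs : J'.Δ = ↑((D.u⁻¹) ^ 12 * hφu.unit) * φ π ^ n := by
      rw [hJ', WeierstrassCurve.variableChange_Δ, hJdef, WeierstrassCurve.map_Δ, hΔ, map_mul,
        map_pow]
      simp only [Units.val_mul, Units.val_pow_eq_pow_val, IsUnit.unit_spec]
      ring
    exact IsDiscreteValuationRing.unit_mul_pow_congr_pow hϖ' hϖ' _ _ m n (hlhs.symm.trans hrhs)
  have key := LocalIndex.index_eq_of_tateNormalForm (K := (maxUnramified (v.adicCompletion K)))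
    J' hϖ' h1 h2 h3 h4 α.isUnit hm1 hα
  rw [hJ', index_nonsingularReductionSubgroup_smul, hmn] at key
  -- so `n • Q ∈ E₀` for every `Q ∈ J(K_v^nr)`
  have hnQ : ∀ Q : (J.baseChange (maxUnramified (v.adicCompletion K))).toAffine.Point,
      J.HasNonsingularReduction (n • Q) := by
    intro Q
    have := (J.nonsingularReductionSubgroup hvR).nsmul_index_mem Q
    rw [key] at this
    exact this
  /- (2) the models `J ⊗ K_v^nr = X ⊗ K_v^nr` and `W₀ = J ⊗ 𝒪_w` with `W₀ ⊗ K̄_v = X ⊗ K̄_v` -/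
  have hX₀K : X₀.baseChange (v.adicCompletion K) = X := rfl
  have hJK : J.baseChange (maxUnramified (v.adicCompletion K)) =
      X.baseChange (maxUnramified (v.adicCompletion K)) := by
    rw [← hX₀K]
    change (X₀.map φ).map (algebraMap _ _) =
      (X₀.map (algebraMap (v.adicCompletionIntegers K) (v.adicCompletion K))).map
        (algebraMap (v.adicCompletion K) (maxUnramified (v.adicCompletion K)))
    rw [WeierstrassCurve.map_map, WeierstrassCurve.map_map]
    congr 1
    refine RingHom.ext fun a ↦ Subtype.ext ?_
    change (((φ a : (Valuation.valuationSubring (Valuation.comap (algebraMap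
      (maxUnramified (v.adicCompletion K)) (AlgebraicClosure (v.adicCompletion K))) w))) :
        (maxUnramified (v.adicCompletion K))) : (AlgebraicClosure (v.adicCompletion K))) =
      ((algebraMap (v.adicCompletion K) (maxUnramified (v.adicCompletion K))
        (algebraMap (v.adicCompletionIntegers K) (v.adicCompletion K) a) :
          (maxUnramified (v.adicCompletion K))) : (AlgebraicClosure (v.adicCompletion K)))
    rw [hφ, IntermediateField.coe_algebraMap_apply]
    rfl
  set W₀ : WeierstrassCurve w.integer := J.map ψ with hW₀def
  have hW₀ : W₀.baseChange (AlgebraicClosure (v.adicCompletion K)) =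
      X.baseChange (AlgebraicClosure (v.adicCompletion K)) := by
    rw [← hX₀K]
    change ((X₀.map φ).map ψ).map (algebraMap _ _) =
      (X₀.map (algebraMap (v.adicCompletionIntegers K) (v.adicCompletion K))).map
        (algebraMap (v.adicCompletion K) (AlgebraicClosure (v.adicCompletion K)))
    rw [WeierstrassCurve.map_map, WeierstrassCurve.map_map, WeierstrassCurve.map_map]
    congr 1
    refine RingHom.ext fun a ↦ ?_
    change ((ψ (φ a) : w.integer) : (AlgebraicClosure (v.adicCompletion K))) =
      algebraMap (v.adicCompletion K) (AlgebraicClosure (v.adicCompletion K))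
        (algebraMap (v.adicCompletionIntegers K) (v.adicCompletion K) a)
    rw [hψ, hφ]
    rfl
  -- the residue field of `𝒪ⁿʳ` embeds into that of `𝒪_w`
  haveI hψloc : IsLocalHom ψ := ⟨fun a ha ↦ by
    by_contra hna
    have hmem : a ∈ maximalIdeal (Valuation.valuationSubring (Valuation.comap (algebraMap
        (maxUnramified (v.adicCompletion K)) (AlgebraicClosure (v.adicCompletion K))) w)) :=
      (IsLocalRing.mem_maximalIdeal _).mpr (mem_nonunits_iff.mpr hna)
    have := (map_mem_maximalIdeal_integer_iff hψ a).mpr hmem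
    exact (mem_nonunits_iff.mp ((IsLocalRing.mem_maximalIdeal _).mp this)) ha⟩
  have hκ : W₀.map (residue w.integer) =
      ((J.map (residue (Valuation.valuationSubring (Valuation.comap (algebraMap
        (maxUnramified (v.adicCompletion K)) (AlgebraicClosure (v.adicCompletion K))) w)))).map
        (IsLocalRing.ResidueField.map ψ)) := by
    rw [hW₀def]
    simp only [WeierstrassCurve.map_map]
    congr 1
  -- the reduction of `W₀` is a node
  have hW₀Δ : IsLocalRing.residue w.integer W₀.Δ = 0 := by
    rw [IsLocalRing.residue_eq_zero_iff, hW₀def, WeierstrassCurve.map_Δ,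
      map_mem_maximalIdeal_integer_iff hψ]
    exact hΔI
  have hW₀c₄ : IsLocalRing.residue w.integer W₀.c₄ ≠ 0 := by
    rw [Ne, IsLocalRing.residue_eq_zero_iff, hW₀def, WeierstrassCurve.map_c₄,
      map_mem_maximalIdeal_integer_iff hψ]
    exact hc₄I
  obtain ⟨r, hr⟩ := W₀.exists_addMonoidHom_units_of_node hv0 hW₀Δ hW₀c₄
  /- (3) the maps on points `J(K_v^nr) ≃ X(K_v^nr) → X(K̄_v)` -/
  set e₁ := WeierstrassCurve.Affine.Point.congrEquiv hJK with he₁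
  set ι : (X.baseChange (maxUnramified (v.adicCompletion K))).toAffine.Point →+
      (X.baseChange (AlgebraicClosure (v.adicCompletion K))).toAffine.Point :=
    WeierstrassCurve.Affine.Point.map (W' := X)
      (IsScalarTower.toAlgHom (v.adicCompletion K) (maxUnramified (v.adicCompletion K))
        (AlgebraicClosure (v.adicCompletion K))) with hι
  have hinjι' : Function.Injective (IsScalarTower.toAlgHom (v.adicCompletion K)
      (maxUnramified (v.adicCompletion K)) (AlgebraicClosure (v.adicCompletion K))) :=
    fun a b hab ↦ Subtype.ext hab
  have hinjι : Function.Injective ι := WeierstrassCurve.Affine.Point.map_injective (W' := X) _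
  -- `I_𝔐`-fixed points of `X(K̄_v)` come from `X(K_v^nr)`
  have hsurj : ∀ P : (X.baseChange (AlgebraicClosure (v.adicCompletion K))).toAffine.Point,
      (∀ σ ∈ 𝔐.inertia (absoluteGaloisGroup (v.adicCompletion K)),
        WeierstrassCurve.Affine.Point.map
          ((absoluteGaloisGroup.toAlgEquiv _ σ : (AlgebraicClosure (v.adicCompletion K))
              ≃ₐ[(v.adicCompletion K)] (AlgebraicClosure (v.adicCompletion K))) :
            (AlgebraicClosure (v.adicCompletion K)) →ₐ[(v.adicCompletion K)]
              (AlgebraicClosure (v.adicCompletion K))) P = P) →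
        ∃ Q, ι Q = P := by
    intro P hP
    rcases P with _ | ⟨x, y, h⟩
    · exact ⟨0, map_zero ι⟩
    · have hx : x ∈ (maxUnramified (v.adicCompletion K)) :=
        (mem_maxUnramified_iff_forall_inertia hw h𝔐).mpr fun σ hσ ↦ by
          have := hP σ hσ
          rw [WeierstrassCurve.Affine.Point.map_some, WeierstrassCurve.Affine.Point.some.injEq] at this
          exact this.1
      have hy : y ∈ (maxUnramified (v.adicCompletion K)) :=
        (mem_maxUnramified_iff_forall_inertia hw h𝔐).mpr fun σ hσ ↦ by
          have := hP σ hσ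
          rw [WeierstrassCurve.Affine.Point.map_some, WeierstrassCurve.Affine.Point.some.injEq] at this
          exact this.2
      have h₀ : (X.baseChange (maxUnramified (v.adicCompletion K))).toAffine.Nonsingular
          ⟨x, hx⟩ ⟨y, hy⟩ :=
        (WeierstrassCurve.Affine.baseChange_nonsingular (W := X)
          (f := IsScalarTower.toAlgHom (v.adicCompletion K) (maxUnramified (v.adicCompletion K))
            (AlgebraicClosure (v.adicCompletion K))) hinjι' ⟨x, hx⟩ ⟨y, hy⟩).mp h
      exact ⟨.some _ _ h₀, rfl⟩
  -- `E₀` of `J` over `𝒪ⁿʳ` maps into `E₀` of `W₀` over `𝒪_w`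
  have hE₀ : ∀ Q : (J.baseChange (maxUnramified (v.adicCompletion K))).toAffine.Point,
      J.HasNonsingularReduction Q →
        W₀.HasNonsingularReduction
          ((WeierstrassCurve.Affine.Point.congrEquiv hW₀).symm (ι (e₁ Q))) := by
    intro Q hQ
    rcases point_cases hvR Q with rfl | ⟨x, y, h, rfl, hx⟩ | ⟨a, b, h, rfl⟩
    · rw [map_zero, map_zero, map_zero]
      exact WeierstrassCurve.hasNonsingularReduction_zero
    · have hx' : 1 < w (x : (AlgebraicClosure (v.adicCompletion K))) := not_le.mp fun hle ↦
        (not_mem_range_iff hvR).mpr hx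
          ⟨⟨x, (Valuation.mem_valuationSubring_iff _ _).mpr hle⟩, rfl⟩
      rw [he₁, WeierstrassCurve.Affine.Point.congrEquiv_some]
      change W₀.HasNonsingularReduction ((WeierstrassCurve.Affine.Point.congrEquiv hW₀).symm
        (WeierstrassCurve.Affine.Point.some _ _ _))
      rw [WeierstrassCurve.Affine.Point.congrEquiv_symm_some]
      refine Or.inl ?_
      rw [not_mem_range_iff hv0]
      exact hx'
    · have hns := (WeierstrassCurve.hasNonsingularReduction_some_algebraMap_iff hinjR h).mp hQ
      rw [he₁, WeierstrassCurve.Affine.Point.congrEquiv_some]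
      change W₀.HasNonsingularReduction ((WeierstrassCurve.Affine.Point.congrEquiv hW₀).symm
        (WeierstrassCurve.Affine.Point.some _ _ _))
      rw [WeierstrassCurve.Affine.Point.congrEquiv_symm_some]
      refine Or.inr ⟨ψ a, ψ b, hψ a, hψ b, ?_⟩
      rw [hκ, ← IsLocalRing.ResidueField.map_residue, ← IsLocalRing.ResidueField.map_residue]
      exact (WeierstrassCurve.Affine.map_nonsingular _
        (IsLocalRing.ResidueField.map ψ).injective _ _).mpr hns
  /- (4) every `p`-torsion point of `X(K̄_v)` has nonsingular reduction on `W₀`: write it as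
    `p^(k-1) • R` with `R ∈ E[p^k]` fixed by inertia, hence `K_v^nr`-rational -/
  haveI : (X.baseChange (AlgebraicClosure (v.adicCompletion K))).IsElliptic := inferInstance
  -- `gcd(n, p^k) ∣ p^(k-1)` since `p^k ∤ n`
  have hgcd : Nat.gcd n (p ^ k) ∣ p ^ (k - 1) := by
    obtain ⟨j, hj, hgj⟩ := (Nat.dvd_prime_pow hp).mp (Nat.gcd_dvd_right n (p ^ k))
    have hjk : j < k := by
      by_contra hjk
      have hjk' : j = k := by omega
      exact hpn (by rw [← hjk', ← hgj]; exact Nat.gcd_dvd_left n (p ^ k))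
    rw [hgj]
    exact pow_dvd_pow p (by omega)
  have hG : ∀ P : (X.baseChange (AlgebraicClosure (v.adicCompletion K))).toAffine.Point,
      p • P = 0 → W₀.HasNonsingularReduction
        ((WeierstrassCurve.Affine.Point.congrEquiv hW₀).symm P) := by
    intro P hP
    -- divide `P` by `p^(k-1)` in `X(K̄_v)`
    obtain ⟨R, hR⟩ := (X.baseChange (AlgebraicClosure (v.adicCompletion K))).nsmul_surjective_of_isAlgClosed
      (n := p ^ (k - 1)) (pow_ne_zero _ hp.ne_zero) P
    have hR' : p ^ (k - 1) • R = P := hR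
    have hRk : p ^ k • R = 0 := by
      calc p ^ k • R = (p * p ^ (k - 1)) • R := by rw [← pow_succ', Nat.sub_add_cancel hk]
        _ = p • (p ^ (k - 1) • R) := mul_smul _ _ _
        _ = 0 := by rw [hR', hP]
    obtain ⟨Q₀, hQ₀R⟩ := hsurj R (fun σ hσ ↦ hall σ hσ R hRk)
    set Q := e₁.symm Q₀ with hQ
    have hQ₀ : Q₀ = e₁ Q := by rw [hQ, AddEquiv.apply_symm_apply]
    rw [hQ₀] at hQ₀R
    -- `p^k • Q = 0`
    have hpQ : p ^ k • Q = 0 := by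
      apply e₁.injective
      apply hinjι
      rw [map_nsmul, map_nsmul, hQ₀R, hRk, map_zero, map_zero]
    -- `gcd(n, p^k) • Q ∈ E₀` by Bezout, hence `p^(k-1) • Q ∈ E₀`
    have hbez := Nat.gcd_eq_gcd_ab n (p ^ k)
    have hgQ : J.HasNonsingularReduction ((Nat.gcd n (p ^ k)) • Q) := by
      have hmem : (n.gcdA (p ^ k)) • ((n : ℤ) • Q) + (n.gcdB (p ^ k)) • (((p ^ k : ℕ) : ℤ) • Q) ∈
          J.nonsingularReductionSubgroup hvR := by
        refine (J.nonsingularReductionSubgroup hvR).add_mem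
          ((J.nonsingularReductionSubgroup hvR).zsmul_mem ?_ _)
          ((J.nonsingularReductionSubgroup hvR).zsmul_mem ?_ _)
        · rw [natCast_zsmul]; exact hnQ Q
        · rw [natCast_zsmul, hpQ]; exact (J.nonsingularReductionSubgroup hvR).zero_mem
      have hEq : (n.gcdA (p ^ k)) • ((n : ℤ) • Q) + (n.gcdB (p ^ k)) • (((p ^ k : ℕ) : ℤ) • Q) =
          ((Nat.gcd n (p ^ k) : ℕ) : ℤ) • Q := by
        rw [smul_smul, smul_smul, ← add_smul, mul_comm (n.gcdA (p ^ k)), mul_comm (n.gcdB (p ^ k)),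
          ← hbez]
      rw [hEq, natCast_zsmul] at hmem
      exact hmem
    have hQE₀ : J.HasNonsingularReduction ((p ^ (k - 1)) • Q) := by
      obtain ⟨c, hc⟩ := hgcd
      rw [hc, mul_comm, mul_nsmul']
      exact (J.nonsingularReductionSubgroup hvR).nsmul_mem hgQ c
    -- `P = ι (e₁ (p^(k-1) • Q))`
    have hPQ : P = ι (e₁ ((p ^ (k - 1)) • Q)) := by rw [map_nsmul, map_nsmul, hQ₀R, hR']
    rw [hPQ]
    exact hE₀ _ hQE₀
  /- (5) counting: the node map embeds the `p`-torsion into the `p`-th roots of unity -/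
  set G := WeierstrassCurve.torsionPoints X (AlgebraicClosure (v.adicCompletion K)) p with hGdef
  have hcardG : Nat.card G = p ^ 2 :=
    WeierstrassCurve.card_torsionPoints_eq_sq_holds X (AlgebraicClosure (v.adicCompletion K)) hpL
  have hGp : ∀ P : G, p • (P : (X.baseChange (AlgebraicClosure (v.adicCompletion K))).toAffine.Point)
      = 0 := fun P ↦ by
    have := (WeierstrassCurve.mem_torsionPoints_iff X (AlgebraicClosure (v.adicCompletion K))
      (P : (X.baseChange (AlgebraicClosure (v.adicCompletion K))).toAffine.Point)).mp P.2
    rwa [natCast_zsmul] at this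
  -- the map `G → \bar k^×`
  set f : G → (AlgebraicClosure (IsLocalRing.ResidueField w.integer))ˣ := fun P ↦
    Additive.toMul (r ⟨(WeierstrassCurve.Affine.Point.congrEquiv hW₀).symm P, hG _ (hGp P)⟩)
    with hf
  -- its values are `p`-th roots of unity
  haveI : NeZero p := ⟨hp.ne_zero⟩
  have hfmem : ∀ P : G, f P ∈ rootsOfUnity p (AlgebraicClosure (IsLocalRing.ResidueField w.integer)) := by
    intro P
    rw [mem_rootsOfUnity, hf]
    change Additive.toMul (r _) ^ p = 1
    rw [← toMul_nsmul, ← map_nsmul]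
    have h0 : p • (⟨(WeierstrassCurve.Affine.Point.congrEquiv hW₀).symm P, hG _ (hGp P)⟩ :
        W₀.nonsingularReductionSubgroup hv0) = 0 :=
      Subtype.ext (by
        change p • (WeierstrassCurve.Affine.Point.congrEquiv hW₀).symm
          (P : (X.baseChange (AlgebraicClosure (v.adicCompletion K))).toAffine.Point) = 0
        rw [← map_nsmul, hGp P, map_zero])
    rw [h0, map_zero, toMul_zero]
  -- it is injective: the kernel of `r` is `E₁`, which has no `p`-torsion
  have hfinj : Function.Injective f := by
    intro P P' hPP'
    have hsub : r (⟨(WeierstrassCurve.Affine.Point.congrEquiv hW₀).symm P, hG _ (hGp P)⟩ -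
        ⟨(WeierstrassCurve.Affine.Point.congrEquiv hW₀).symm P', hG _ (hGp P')⟩) = 0 := by
      rw [map_sub, sub_eq_zero]
      exact Additive.toMul.injective hPP'
    rw [hr] at hsub
    change W₀.ReducesToZero ((WeierstrassCurve.Affine.Point.congrEquiv hW₀).symm P -
      (WeierstrassCurve.Affine.Point.congrEquiv hW₀).symm P') at hsub
    rw [← map_sub] at hsub
    have htor : (p : ℤ) • (WeierstrassCurve.Affine.Point.congrEquiv hW₀).symm
        ((P : (X.baseChange (AlgebraicClosure (v.adicCompletion K))).toAffine.Point) - P') = 0 := by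
      rw [← map_zsmul, smul_sub, natCast_zsmul, natCast_zsmul, hGp P, hGp P', sub_self, map_zero]
    have h0 := hsub.eq_zero_of_zsmul_eq_zero W₀ hpw htor
    rw [AddEquiv.map_eq_zero_iff (WeierstrassCurve.Affine.Point.congrEquiv hW₀).symm, sub_eq_zero]
      at h0
    exact Subtype.ext h0
  -- `p² = #G ≤ #μ_p ≤ p`
  set f' : G → rootsOfUnity p (AlgebraicClosure (IsLocalRing.ResidueField w.integer)) :=
    fun P ↦ ⟨f P, hfmem P⟩ with hf'
  have hf'inj : Function.Injective f' := fun P P' h ↦ hfinj (congrArg Subtype.val h)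
  have hle : Nat.card G ≤ p :=
    (Nat.card_le_card_of_injective f' hf'inj).trans (card_rootsOfUnity _ p)
  rw [hcardG] at hle
  have : p < p ^ 2 := lt_self_pow₀ hp.one_lt (by norm_num)
  omega

end IsDedekindDomain.HeightOneSpectrum

end
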